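import Summits.CriticalPhenomena.PercolationContinuityZ3.Theses.PercBoundarySqueeze
import Summits.CriticalPhenomena.PercolationContinuityZ3.Theses.PercDebrisSweep
import Literature.Probability.Percolation.KestenZhangAssembly
import HarnessLib

/-!
# Crux `PercBoundarySqueeze.FreeBoxFatClusterMass` (stmt-CriticalPhenomena-6982), line `registered`,
# stub `stub_finiteClusterTail` — the conditional reductions that close (supports, does not close)

The registered stub A of the line's skeleton (`Cruxes/FreeBoxFatClusterMass/Lines/registered.lean`)
asks for a power-law upper tail for the volume of the FINITE critical cluster of bond percolation
on `ℤ³`: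

  `∃ c₀ > 0, C : ∀ real s ≥ 1, P_{p_c}(|C(0)| < ∞ ∧ s ≤ |C(0)|) ≤ C · s^{-c₀}`

("`1/δ > 0` for finite clusters"; verbatim the hypothesis of the sibling crux's exchange rate
`FreeBoxPowerSavingLine.ExchangeRates.confinedQuasiGiantsVanish_of_finiteClusterTail`).
It is NOT proved here.  Status of the search (2026-08-17): the tree has critical volume-tail upper
bounds only under the triangle condition (`MeanFieldDelta.real_clusterSizeGe_criticalProb_le_of_gamma`,
mean field) or through Hutchcroft's entropic sprinkling
(`SubexponentialGrowthZdNarrow.real_clusterSizeGe_criticalProb_le`, which needs a sub-quadratic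
SUBCRITICAL susceptibility bound `γ < 2`, open for `3 ≤ d ≤ 6`, and would give `θ(p_c) = 0`
outright); the Kesten–Zhang apparatus (`KestenZhang*.lean`, `Grimmett1999_thm_8_65_holds`) is for
`p > p_c` only; the stockroom has no percolation entries; in print only the Aizenman–Barsky LOWER
bound `P_{p_c}(|C| ≥ s) ≥ c s^{-1/2}` (Grimmett 1999 Prop. 10.29) and mean field are known, and
Hutchcroft 2020 (arXiv:1901.10363) Thm 1.1 ASSUMES such an upper bound.

What this file kernel-checks (sorry-free, no new definitions):

* `tailEvent_three_eq` — the stub's event at an integer threshold `m` IS the tree's Kesten–Zhang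
  event `KestenZhang.tailEvent 3 m = {m ≤ |C(0)| < ∞}` (for a finite set `encard = ncard`);
* `finiteClusterTail_iff_natTail` — the stub ⟺ its `ℕ`-indexed form
  `∃ c₀ > 0, C : ∀ m ≥ 1, P_{p_c}(tailEvent 3 m) ≤ C m^{-c₀}` (real thresholds `s` are absorbed by
  `m = ⌈s⌉₊`, since `|C(0)|` is an integer);
* `finiteClusterTail_of_stretchedExpTail` — ANY stretched-exponential bound
  `P_{p_c}(tailEvent 3 m) ≤ exp(-c m^a)` (`a, c > 0`, all `m ≥ 1`) gives the stub with `c₀ = a`,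
  `C = 1/c` (`exp(-x) ≤ 1/x` for `x > 0`, from `Real.add_one_le_exp`);
* `finiteClusterTail_of_jump_of_finiteClusterVolumeTail` — **the jump branch**: if `θ(p_c) > 0`,
  the shared open crux stmt-CriticalPhenomena-0943 `PercDebrisSweep.FiniteClusterVolumeTail`
  (Kesten–Zhang at the same density: `θ(p) > 0 ⇒ P_p(m ≤ |C(0)| < ∞) ≤ exp(-c m^{2/3})`),
  instantiated at `p = p_c`, gives the stub with `c₀ = 2/3`;
* `finiteClusterTail_mono` — monotonicity in the exponent / constant.

So in the branch `θ(p_c) > 0` the stub is reduced to the existing item stmt-0943; in the branch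
`θ(p_c) = 0` (where the stub reads `P_{p_c}(|C(0)| ≥ s) ≤ C s^{-c₀}`, a bulk critical volume
exponent bound) no item or fact of the tree implies it.
-/

noncomputable section

namespace Summit.CriticalPhenomena.PercolationContinuityZ3.FreeBoxFatClusterMassLine

open MeasureTheory
open Literature.Probability.Percolation Literature.Probability.LatticeModels
open scoped Classical

/-- **The stub's event at an integer threshold is the Kesten–Zhang tail event.**  For `m : ℕ`,
`KestenZhang.tailEvent 3 m = {ω | (m : ℕ∞) ≤ |C(0)|.encard ∧ C(0) finite}` equals
`{ω | C(0) finite ∧ (m : ℝ) ≤ |C(0)|.ncard}` (for a finite set `encard = ncard`). [folklore] -/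
theorem tailEvent_three_eq (m : ℕ) :
    KestenZhang.tailEvent 3 m =
      {ω | (openCluster ω (0 : Site 3)).Finite ∧
        (m : ℝ) ≤ ((openCluster ω (0 : Site 3)).ncard : ℝ)} := by
  ext ω
  simp only [KestenZhang.tailEvent, Set.mem_setOf_eq]
  constructor
  · rintro ⟨hm, hfin⟩
    refine ⟨hfin, ?_⟩
    rw [← hfin.cast_ncard_eq] at hm
    exact_mod_cast hm
  · rintro ⟨hfin, hm⟩
    refine ⟨?_, hfin⟩
    rw [← hfin.cast_ncard_eq]
    exact_mod_cast hm

/-- **Real thresholds versus integer thresholds.**  For real `s` the stub's event is contained in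
the Kesten–Zhang tail event at `m = ⌈s⌉₊` (`|C(0)|` is an integer, so `s ≤ |C(0)|` forces
`⌈s⌉₊ ≤ |C(0)|`). [folklore] -/
theorem finiteTail_subset_tailEvent_ceil (s : ℝ) :
    {ω | (openCluster ω (0 : Site 3)).Finite ∧
        s ≤ ((openCluster ω (0 : Site 3)).ncard : ℝ)} ⊆ KestenZhang.tailEvent 3 ⌈s⌉₊ := by
  rintro ω ⟨hfin, hs⟩
  rw [tailEvent_three_eq]
  refine ⟨hfin, ?_⟩
  exact_mod_cast Nat.ceil_le.2 hs

/-- **The stub ⟺ its `ℕ`-indexed form on the Kesten–Zhang event.**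
`(∃ c₀ > 0, C : ∀ real s ≥ 1, P_{p_c}(|C(0)| < ∞ ∧ s ≤ |C(0)|) ≤ C s^{-c₀}) ↔
 (∃ c₀ > 0, C : ∀ m ≥ 1, P_{p_c}(tailEvent 3 m) ≤ C m^{-c₀})`.
(`→`: take `s = m`; `←`: take `m = ⌈s⌉₊ ≥ s ≥ 1` and use `m^{-c₀} ≤ s^{-c₀}`, with the constant
replaced by `max C 0`.) [folklore] -/
theorem finiteClusterTail_iff_natTail :
    (∃ c₀ C : ℝ, 0 < c₀ ∧ ∀ s : ℝ, 1 ≤ s →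
      (bondPercolation (zdGraph 3) (criticalProbI 3)).real
        {ω | (openCluster ω (0 : Site 3)).Finite ∧ s ≤ ((openCluster ω (0 : Site 3)).ncard : ℝ)}
        ≤ C * s ^ (-c₀)) ↔
    (∃ c₀ C : ℝ, 0 < c₀ ∧ ∀ m : ℕ, 1 ≤ m →
      (bondPercolation (zdGraph 3) (criticalProbI 3)).real (KestenZhang.tailEvent 3 m)
        ≤ C * (m : ℝ) ^ (-c₀)) := by
  constructor
  · rintro ⟨c₀, C, hc₀, h⟩
    refine ⟨c₀, C, hc₀, fun m hm => ?_⟩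
    rw [tailEvent_three_eq]
    exact h (m : ℝ) (by exact_mod_cast hm)
  · rintro ⟨c₀, C, hc₀, h⟩
    refine ⟨c₀, max C 0, hc₀, fun s hs => ?_⟩
    set μ := bondPercolation (zdGraph 3) (criticalProbI 3) with hμ
    have hs0 : 0 < s := by linarith
    have hm1 : 1 ≤ ⌈s⌉₊ := Nat.one_le_cast.1 ((hs.trans (Nat.le_ceil s)))
    have hms : s ≤ (⌈s⌉₊ : ℝ) := Nat.le_ceil s
    have hm0 : (0 : ℝ) < ⌈s⌉₊ := hs0.trans_le hms
    -- `m^{-c₀} ≤ s^{-c₀}` since `s ≤ m` and `-c₀ ≤ 0`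
    have hpow : (⌈s⌉₊ : ℝ) ^ (-c₀) ≤ s ^ (-c₀) :=
      Real.rpow_le_rpow_of_nonpos hs0 hms (by linarith)
    calc μ.real {ω | (openCluster ω (0 : Site 3)).Finite ∧
            s ≤ ((openCluster ω (0 : Site 3)).ncard : ℝ)}
        ≤ μ.real (KestenZhang.tailEvent 3 ⌈s⌉₊) :=
          measureReal_mono (finiteTail_subset_tailEvent_ceil s)
      _ ≤ C * (⌈s⌉₊ : ℝ) ^ (-c₀) := h ⌈s⌉₊ hm1
      _ ≤ max C 0 * (⌈s⌉₊ : ℝ) ^ (-c₀) :=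
          mul_le_mul_of_nonneg_right (le_max_left _ _) (Real.rpow_nonneg hm0.le _)
      _ ≤ max C 0 * s ^ (-c₀) := mul_le_mul_of_nonneg_left hpow (le_max_right _ _)

/-- **Any stretched-exponential tail gives the stub.**  If `P_{p_c}(m ≤ |C(0)| < ∞) ≤ exp(-c m^a)`
for all `m ≥ 1` with `a > 0`, `c > 0`, then the stub holds with `c₀ = a` (and `C = max (1/c) 0`):
`exp(-c m^a) ≤ 1/(c m^a) = c⁻¹ m^{-a}` by `1 + x ≤ exp x`. [folklore] -/
theorem finiteClusterTail_of_stretchedExpTail {a c : ℝ} (ha : 0 < a) (hc : 0 < c)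
    (h : ∀ m : ℕ, 1 ≤ m →
      (bondPercolation (zdGraph 3) (criticalProbI 3)).real (KestenZhang.tailEvent 3 m)
        ≤ Real.exp (-(c * (m : ℝ) ^ a))) :
    ∃ c₀ C : ℝ, 0 < c₀ ∧ ∀ s : ℝ, 1 ≤ s →
      (bondPercolation (zdGraph 3) (criticalProbI 3)).real
        {ω | (openCluster ω (0 : Site 3)).Finite ∧ s ≤ ((openCluster ω (0 : Site 3)).ncard : ℝ)}
        ≤ C * s ^ (-c₀) := by
  refine finiteClusterTail_iff_natTail.2 ⟨a, 1 / c, ha, fun m hm => (h m hm).trans ?_⟩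
  have hm1 : (1 : ℝ) ≤ m := by exact_mod_cast hm
  have hm0 : (0 : ℝ) < m := by linarith
  have hma : 0 < (m : ℝ) ^ a := Real.rpow_pos_of_pos hm0 a
  have hx : 0 < c * (m : ℝ) ^ a := mul_pos hc hma
  -- `exp(-x) ≤ 1/x` for `x > 0`
  have hexp : Real.exp (-(c * (m : ℝ) ^ a)) ≤ 1 / (c * (m : ℝ) ^ a) := by
    rw [Real.exp_neg, ← one_div]
    exact one_div_le_one_div_of_le hx (by linarith [Real.add_one_le_exp (c * (m : ℝ) ^ a)])
  calc Real.exp (-(c * (m : ℝ) ^ a)) ≤ 1 / (c * (m : ℝ) ^ a) := hexp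
    _ = 1 / c * (m : ℝ) ^ (-a) := by
        rw [Real.rpow_neg hm0.le, one_div, mul_inv, one_div]

/-- **Jump branch: `θ(p_c) > 0` and the shared crux stmt-CriticalPhenomena-0943
(`PercDebrisSweep.FiniteClusterVolumeTail`, Kesten–Zhang at the same density) give the stub**, with
`c₀ = 2/3`: instantiate K at `p = p_c(ℤ³)` (admissible since `θ(p_c) > 0`), identify its event
`{(m : ℕ∞) ≤ |C(0)|.encard ∧ C(0) finite}` with `KestenZhang.tailEvent 3 m`, and bound
`exp(-c m^{2/3}) ≤ c⁻¹ m^{-2/3}`.  (K is an OPEN item; it enters only as an explicit hypothesis.)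
[folklore] -/
theorem finiteClusterTail_of_jump_of_finiteClusterVolumeTail :
    0 < theta (zdGraph 3) 0 (criticalProbI 3) →
      Summit.CriticalPhenomena.PercolationContinuityZ3.Theses.PercDebrisSweep.FiniteClusterVolumeTail →
        ∃ c₀ C : ℝ, 0 < c₀ ∧ ∀ s : ℝ, 1 ≤ s →
          (bondPercolation (zdGraph 3) (criticalProbI 3)).real
            {ω | (openCluster ω (0 : Site 3)).Finite ∧ s ≤ ((openCluster ω (0 : Site 3)).ncard : ℝ)}
            ≤ C * s ^ (-c₀) := by
  intro hθ hK
  obtain ⟨c, hc, h⟩ := hK (criticalProbI 3) hθ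
  exact finiteClusterTail_of_stretchedExpTail (a := (2 : ℝ) / 3) (by norm_num) hc fun m hm => h m hm

/-- **Monotonicity of the stub's bound in the exponent and the constant.**  A tail bound with
exponent `c₀` and constant `C` on `s ≥ 1` implies the bound with any smaller positive exponent
`c₀' ≤ c₀` and the constant `max C 0` (`s^{-c₀} ≤ s^{-c₀'}` for `s ≥ 1`). [folklore] -/
theorem finiteClusterTail_mono {c₀ c₀' C : ℝ} (hle : c₀' ≤ c₀)
    (h : ∀ s : ℝ, 1 ≤ s →
      (bondPercolation (zdGraph 3) (criticalProbI 3)).real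
        {ω | (openCluster ω (0 : Site 3)).Finite ∧ s ≤ ((openCluster ω (0 : Site 3)).ncard : ℝ)}
        ≤ C * s ^ (-c₀)) :
    ∀ s : ℝ, 1 ≤ s →
      (bondPercolation (zdGraph 3) (criticalProbI 3)).real
        {ω | (openCluster ω (0 : Site 3)).Finite ∧ s ≤ ((openCluster ω (0 : Site 3)).ncard : ℝ)}
        ≤ max C 0 * s ^ (-c₀') := by
  intro s hs
  have hs0 : 0 < s := by linarith
  calc (bondPercolation (zdGraph 3) (criticalProbI 3)).real
          {ω | (openCluster ω (0 : Site 3)).Finite ∧ s ≤ ((openCluster ω (0 : Site 3)).ncard : ℝ)}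
        ≤ C * s ^ (-c₀) := h s hs
    _ ≤ max C 0 * s ^ (-c₀) :=
        mul_le_mul_of_nonneg_right (le_max_left _ _) (Real.rpow_nonneg hs0.le _)
    _ ≤ max C 0 * s ^ (-c₀') :=
        mul_le_mul_of_nonneg_left (Real.rpow_le_rpow_of_exponent_le hs (by linarith))
          (le_max_right _ _)

end Summit.CriticalPhenomena.PercolationContinuityZ3.FreeBoxFatClusterMassLine

end
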